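import Mathlib
import HarnessLib
import HarnessLib.Audit
import Summits.QuantumFields.Statement
import Literature.MathematicalPhysics.QuantumFieldTheory.YangMillsOS

/-!
Route: ContractibleFibre

DORMANT since 2026-09-05T00:13:45Z (reconciler: no traction for 5 d (last activity statement-checked at 2026-08-30T23:36:16Z); parked, not closed — `ledger route dormant route-QuantumFields-ContractibleFibre --off` to reactivate) — unstaffed, not closed; items shared with open routes are served there. `ledger route dormant <id> --off` reactivates.

# Route ContractibleFibre — Contractible fibre — Wilson's theory on (ℤ/L)²×[0,M]² is a 2-d quiver
gauge theory with no moduli for every G; KK-gapped anchor at fixed width, continuity in the width,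
free-to-torus transfer

It suffices to show X = FibreAnchor ∧ FibreContinuity ∧ FibreToTorus together with the WEAK-COUPLING
existence leg WeakCouplingContinuumLeg (= the shared leg stmt-QuantumFields-8782 with the conjunct
`sch.HasWeakCouplingLimit` — β_k = 2/g₀² → ∞ along the scheme — added to its conclusion;
route-repair 2026-08-16 after the re-type of `YangMills`, p116790; the superseded leg
ContinuumLegGivenGap is implied by it and no longer an item of this route) — RESURRECT-2001 of the
earlier programme's `summits/ym/routes/sphere-compactification` (STATUS upheld: Gaussian theorem
"gauge-invariant two-point functions on ℤ²×F cluster iff H¹(F;ℝ)=0, sharp rate arccosh(1+λ₁/2)";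
non-abelian fixed-F theorem reduced to a Pirogov–Sinai stability input, three attempts; nothing
uniform in F) merged with `free-slab-reduction` (STATUS proving, notes only), re-typed in the FLAT
free-square-fibre form the 2001 note itself lists as the repair ("free square Q_R"): Wilson's
G-theory in the faithful representation r on the FREE TUBE (ℤ/L)²×{0..M}² — two long periodic
directions of equal length L (time among them), two fibre directions with FREE boundary (plaquettes
leaving the tube carry weight 0), product Haar. FibreAnchor: at FIXED width M, for β ≥ β₀(M),
time-clustering of all bounded time-slab observables at a β-UNIFORM rate m₀(M) > 0 on all tubes L ≥
L_min(β,M,w). FibreContinuity: given the anchor, for all large β ONE rate m(β) > 0 with constants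
uniform in M clusters the free tubes of EVERY width. FibreToTorus: that family ⇒ the symmetric-torus
weak-coupling lattice gap UniformLatticeGap (target, stmt-QuantumFields-8778 verbatim). No idea card
is realised (novel-route lens resurrect-2001).
Lean: `FibreAnchor ∧ FibreContinuity ∧ FibreToTorus ∧ WeakCouplingContinuumLeg` (decls of this
route; every body is a closed one-line Prop over
Literature.MathematicalPhysics.QuantumFieldTheory.{IsCompactSimpleLieGroup, LatticeRep,
haarProbability, YMSpecies, latticeConnectedCorr, SpeciesScheme, SpeciesScheme.HasWeakCouplingLimit,
OSData, IsYangMillsFor, HasLatticeMassGap} and Mathlib, the free-tube vocabulary inlined as `let`s;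
rc 0 in Sketch.lean incl. the re-elaborated `closes` against the re-typed Statement, axioms
propext/Classical.choice/Quot.sound)

## Assembly
Pure logic (theorem `closes` in Sketch.lean = glue.lean, sorry-free, axioms propext /
Classical.choice / Quot.sound): fix a compact simple G with its instances; WeakCouplingContinuumLeg
reduces `YangMills` for G — including its new first conjunct `sch.HasWeakCouplingLimit`, which the
leg's witness scheme carries — to the UniformLatticeGap body for every faithful r (Borel σ-algebra
put on G by `letI := borel G` exactly as the Statement does); for such r, FibreAnchor G r is the
hypothesis of FibreContinuity G r, whose conclusion is the hypothesis of FibreToTorus G r, whose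
conclusion is that body. The three inline `let Tube := …` vocabularies are syntactically identical,
so the composition is `refine hW G hG fun r => ?_; exact hT G hG r (hC G hG r (hA G hG r))`.
UniformLatticeGap (target) and PlanarAnchor (support) are not hypotheses of `closes`.

Rationale: WHY THIS LINE. The contractible fibre is a TOPOLOGICAL infrared regulator: on ℤ²×[0,M]² (as on
ℝ²×S²_R of the 2001 route, hep-th/0310285 physics) the only flat connection is A = 0 modulo gauge
for EVERY compact G, there is no gauge-invariant holonomy around the fibre (no Polyakov loop, no
flux sector, no toron, hence no centre symmetry that could break — the Borgs–Seiler mechanism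
BorgsSeiler1983 and Eguchi–Kawai breaking have nothing to act on), and the Kaluza–Klein content is
explicit: Wilson's theory on ℤ²×F IS a two-dimensional quiver gauge theory on the fibre graph F —
one layer of 2-d lattice Yang–Mills (exactly solvable: product-Haar plaquettes with free b.c.,
characters on the torus; doi:10.1103/PhysRevD.21.446, doi:10.1007/BF01218586, arXiv:0804.2230) per
fibre site, G-valued bifundamental link fields per fibre edge with hopping β, i.e. lattice
deconstruction (hep-th/0104005) read backwards — with tree-level masses the fibre Neumann-Laplacian
spectrum ≥ 2−2cos(π/(M+1)) and flavour-'t Hooft coupling g₂²·N_f ≈ 2/β INDEPENDENT of M. Imported: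
constructive 2-d polymer/contour expansions (KoteckyPreiss1986) for the anchor, the Cao–Sheffield
slab heuristics for Gaussian forms (arXiv:2406.19321 §10, p. 50: "the slab behaves qualitatively
like 2D … we might expect mass gap") which the 2001 Gaussian theorem made rigorous for every fibre
complex, and the Osterwalder–Seiler transfer-matrix dictionary OsterwalderSeiler1978. What no prior
route does: every lattice-gap-first route of this hub anchors at strong coupling (GronwallGap), in
the coupling-blind functional-inequality/TV-mixing idiom (FradkinShenkerFlow, OneCertifiedCube,
ConvexGribovBody), or on a PERIODIC thermal circle that must be deformed by an abelianising pinning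
and continued in (T, s) (SmallCircleAnchor, needs a regular class and 3-d Debye screening,
centre-free groups by Lie theory); here the action is Wilson's verbatim on a sub-complex of ℤ⁴, the
∀G quantifier (G₂, F₄, E₈ included) is met by topology, the anchor is a weak-coupling 2-d problem
around a PRODUCT measure, and the U(1) calibration (free photon: width-uniform gap FALSE on free
slabs, 2001 free-slab notes; Guth/Fröhlich–Spencer) shows exactly where asymptotic freedom must
enter FibreContinuity: the KK quiver matter is adjoint-CHARGED for non-abelian G (confined in 2-d)
and NEUTRAL for U(1). Negatives index (4 entries, 1 YangMills: DiagonalMirrorRP misstatement)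
untouched.

RANKED CRUXES. #0 UniformLatticeGap (target) — (shared VERBATIM with routes ConvexGribovBody /
SmallCircleAnchor, stmt-QuantumFields-8778) for every compact simple G and faithful unitary lattice
representation r there is β₀ with: for all β ≥ β₀ there are m > 0 and S₁ such that for all
gauge-invariant local observables A, B there is C with |⟨A·τ_n B⟩ − ⟨A⟩⟨B⟩| ≤ C e^(−m n) on every
torus (2S+1)⁴, S ≥ S₁, n ≤ S (the `latticeConnectedCorr` shape of `HasLatticeMassGap` at fixed β).
Implied by FibreAnchor → FibreContinuity → FibreToTorus (theorem `target_of_cruxes` in Sketch.lean,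
sorry-free). (why it might fail: It is the weak-coupling lattice mass gap (Chatterjee Problem 5.1
first half): nothing is proved for non-abelian G in d = 4 beyond strong coupling; a massless phase
at some large β (as for U(1)) refutes it.) [arXiv:1803.01950, JaffeWitten2000,
OsterwalderSeiler1978, Literature.MathematicalPhysics.QuantumFieldTheory.LatticeMassGapAllCouplings]
#2 FibreContinuity (crux) — (THE CRUX — continuity in the fibre width; 2001 sphere-compactification
Path 4 "inf_R m(R) > 0", never attacked there) for every compact simple G and faithful unitary r: IF
the fixed-width anchor holds (verbatim FibreAnchor's conclusion: for every M there are β₀(M), m₀(M)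
> 0 such that for β ≥ β₀(M) the free tube (ℤ/L)²×{0..M}² clusters in time at rate m₀(M), constants
C(M,β,w), volume floor L_min), THEN there is β₁ such that for every β ≥ β₁ ONE rate m(β) > 0 and,
for each slab width w, ONE constant C (uniform in the fibre width M) give |E[F₁·F₂∘σ_n] −
E[F₁]E[F₂∘σ_n]| ≤ C e^(−m n), 2n < L, for all bounded measurable time-slab observables, on the free
tubes of EVERY width M ≥ 0 and all L ≥ L_min(β,M,w). Free tube: sites (ℤ/L)×(ℤ/L)×Fin(M+1)×Fin(M+1),
links (site, direction ∈ Fin 4), weight exp(β Σ_x Σ_(μ<κ) 1[plaquette inside the tube]·Re tr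
r.ρ(U_P)) w.r.t. product Haar (fibre plaquettes that would wrap Fin(M+1) get weight 0 = free
boundary; the dangling top-layer fibre links are decoupled Haar variables), σ_n = time shift,
observables depending on links based at times in [c, c+w]. In the quiver dictionary: the 2-d
adjoint-quiver gauge theory at flavour-'t Hooft coupling 2/β keeps a gap bounded below uniformly in
the number (M+1)² of KK flavours although the lightest tree-level KK mass 2−2cos(π/(M+1)) → 0 —
dimensional transmutation seen from two dimensions. [deps: FibreAnchor] [difficulty: open-problem]
(why it might fail: At M ≍ ξ(β) the quiver is strongly coupled (g₂²N/m_KK² = O(1)) and no expansion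
is known; the statement is FALSE for U(1) (free photon KK tower, gap ≍ π/M → 0), so a proof must
consume asymptotic freedom; free 3-d faces might carry wall states below the bulk gap.)
[arXiv:2406.19321, hep-th/0310285, BorgsSeiler1983, arXiv:1105.4749, arXiv:1803.01950,
doi:10.1103/PhysRevD.21.2291] #3 FibreAnchor (crux) — (THE ANCHOR — the 2001 sphere-compactification
target theorem in free-square form; its Gaussian shadow is the upheld 2001 theorem, rate
arccosh(1+λ₁/2), λ₁ = 2−2cos(π/(M+1)) here) for every compact simple G, faithful unitary r and EVERY
fibre width M there are β₀(M) and a β-UNIFORM rate m₀(M) > 0 such that for all β ≥ β₀(M) and every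
slab width w there are C and a volume floor L_min with: on every free tube (ℤ/L)²×{0..M}² with L ≥
L_min, every pair of bounded measurable time-slab observables clusters in time, |E[F₁·F₂∘σ_n] −
E[F₁]E[F₂∘σ_n]| ≤ C e^(−m₀ n) for 2n < L (same inline vocabulary as FibreContinuity). Intended
proof: axial/tree gauge in the fibre ⇒ 2-d G-gauge field + (M+1)²−1 G-valued adjoint scalars with KK
mass terms from the mixed plaquettes; at large β a small-field Gaussian (fibre Hodge spectrum, H¹ =
0) plus a 2-d polymer expansion in the long directions around the product-Haar plaquette measure
(large fields by a Peierls/contour bound with phases = irreps, as in the 2001 "2-d Yang–Mills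
perturbed by a positive hard-core polymer gas"); the volume floor L_min(β,M) ≍ m₀/σ₂(β,M) pushes the
spatial torelons (mass σ₂·L, σ₂ ≍ C₂/(2β(M+1)²)) above m₀. [difficulty: XL] (why it might fail:
β-uniformity of the rate at fixed M may be spoiled by the 2-d string tension σ₂ → 0 (dense KK-pair
bound states at threshold) or by metastable centre-element links for SU(N≥5)/large r (the
Pirogov–Sinai 'unstable phases' the 2001 route met three times).) [arXiv:2406.19321,
KoteckyPreiss1986, doi:10.1103/PhysRevD.21.446, doi:10.1007/BF01218586, arXiv:0804.2230,
OsterwalderSeiler1978] #4 FibreToTorus (crux) — (FREE TUBES ⇒ SYMMETRIC TORUS) for every compact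
simple G and faithful unitary r: IF there is β₁ such that for every β ≥ β₁ one rate m(β) > 0 and
M-uniform constants cluster the free tubes of every width (verbatim the conclusion of
FibreContinuity), THEN the UniformLatticeGap body holds for r: β₀, and for β ≥ β₀ a rate m > 0 and
S₁ with |latticeConnectedCorr r.ρ β (2S+1) A.F B.F n| ≤ C(A,B) e^(−m n) for all YMSpecies A, B, all
S ≥ S₁, n ≤ S. Intended proof: M, L → ∞ along the floors gives free-tube thermodynamic-limit states
on ℤ⁴ that are reflection positive in time and cluster at rate m(β) with the M-uniform constants;
identify them with the periodic-torus states on gauge-invariant local observables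
(b.c.-insensitivity at distance ≫ 1/m from the free faces, Lüscher–Schaefer open-boundary zone),
then transfer time-clustering to latticeConnectedCorr on (2S+1)⁴ with S-uniform constants (vacuum
dominance for n ≤ S, the 2001 ym-w-pingap / ym-w-vdom passage rows). [deps: FibreContinuity]
[difficulty: L] (why it might fail: Free-tube limit states and symmetric-torus states may differ at
weak coupling (ℤ⁴ Gibbs uniqueness at large β is open; 2001 found free ≠ wired states on hyperbolic
lattices); S-uniform constants on the torus need vacuum dominance (Casimir-energy decay), not just a
gap.) [arXiv:1105.4749, OsterwalderSeiler1978, arXiv:2006.16229, Seiler1982, arXiv:1803.01950] #5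
WeakCouplingContinuumLeg (crux) — (IMPORTED COMPLEMENT AT WEAK COUPLING — the shared existence leg
stmt-QuantumFields-8782 of ConvexGribovBody / SmallCircleAnchor / this route with the conjunct
`sch.HasWeakCouplingLimit` of the re-typed `YangMills` (p116790, semantic-vacuity audit §2.4-D)
added to its conclusion; legs L2/L3 of the Clay problem, not attacked by this route) for every
compact simple Lie group G: IF for every faithful unitary r the volume-uniform weak-coupling lattice
gap holds (UniformLatticeGap body for G, Borel σ-algebra: β₀(r) and, for every β ≥ β₀, a rate m(β) >
0 with S-uniform constants), THEN there are r, a sequential scheme sch whose inverse bare couplings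
diverge, β_k → ∞ (`sch.HasWeakCouplingLimit`), and OS data T with IsYangMillsFor r sch T, T
non-trivial and non-Gaussian in tr F², and Δ > 0 with T.HasMassGap Δ ∧ HasLatticeMassGap r sch Δ.
How the new conjunct is supplied: the hypothesis is a lattice gap for EVERY β ≥ β₀(r), so the leg
may — and, for a_k → 0 at fixed physical gap, must — run the bare coupling to zero: take β_k ≥ β₀
with β_k ↑ ∞, a_k := the spacing set by a reference lattice mass at β_k (a_k ∝ m_ref(β_k), so a_k →
0 exactly when ξ(β_k) → ∞: the critical point used is the Gaussian one at β = ∞ of asymptotic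
freedom, never a finite-β one), L_k ≥ S₁(β_k) with a_k L_k → ∞; HasLatticeMassGap r sch Δ is then
UniformLatticeGap at β = β_k in physical units once the prefactors C(A,B;β_k) are k-uniform (RP
transfer-matrix spectral gap), and the joint continuum limit with E0–E4, non-triviality and
non-Gaussianity is constructed at that scale. [deps: UniformLatticeGap] [difficulty: open-problem]
(why it might fail: Joint O(4)-invariant continuum limit of all gauge-invariant fields and
non-Gaussianity of tr F² are open; β_k → ∞ with a_k → 0 at a fixed physical gap needs ξ(β) → ∞ as β
→ ∞ (unproved for non-abelian G, d = 4) and k-uniform gap prefactors.) [JaffeWitten2000,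
Balaban1989LargeFieldII, arXiv:1803.01950, OsterwalderSeiler1978, arXiv:2401.10507, Creutz2022,
Literature.Barriers.QuantumFields.UVStabilityNonUniqueness] #9 PlanarAnchor (support) — (SPECIAL
CASE M = 0 of FibreAnchor — the planar member, implied by instantiation, theorem `planar_of_anchor`
in Sketch.lean) with a one-point fibre the free tube is two-dimensional lattice Yang–Mills in the
representation r on the torus (ℤ/L)² (plus decoupled dangling links): exactly solvable by the
character expansion; time-slab observables cluster at a β-uniform rate m₀ once L ≥ L_min(β) ≍
m₀·2β/C₂(r) (the only slow modes are the spatial Polyakov loop / torelon sectors, mass σ₂(β)·L with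
σ₂ ≍ C₂/(2β·dim)). The calibration of the inline vocabulary and the first milestone (2-d transfer
matrix on class functions of one holonomy × independent plaquette variables). [difficulty: M]
[doi:10.1103/PhysRevD.21.446, doi:10.1007/BF01218586, arXiv:0804.2230, OsterwalderSeiler1978]

TWO-LAYER PLAN. FibreAnchor ⇐ SmallFieldQuiver (Gaussian + convergent perturbation of the KK quiver
at fixed M: clustering of small-field-restricted expectations at rate 2·arccosh(1+λ₁/2)·(1−ε)) →
LargeFieldPeierls (contour/Peierls bound for plaquettes with 1 − Re tr/dim ≥ η in the long
directions, phases = irreps, uniformly in L) → FibreAnchor; foreseen once PlanarAnchor (M = 0) and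
the M = 1 case close. FibreContinuity ⇐ FemtoWidth (m(β,M) ≥ c/M for M ≤ ε·ξ(β): the anchor made
uniform while the running coupling at scale M is small — Bałaban-type UV control with two free
faces, the 2001 free-slab 'reflection/doubling principle') → CrossoverWidth (one rate for ε·ξ(β) ≤ M
≤ ∞: the honest infrared core) → FibreContinuity.

KILL CRITERIA. Refutation of FibreContinuity for some compact simple G (a width window where
volume-uniform time-clustering provably fails at arbitrarily large β — e.g. a surface phase on the
free faces, or a first-order bulk transition in M) closes the route `refuted:FibreContinuity`; there
is no pivot inside this line (the periodic-fibre variants need flux or deformation and are other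
routes). Refutation of FibreAnchor at some fixed M (β-uniform rate impossible, e.g. a provable
σ₂-slow gauge-invariant LOCAL channel surviving the volume floor) forces a pivot to β-dependent
anchor rates m₀(M,β) with the continuity crux restated over them (route edit --restate), not a
closure. Refutation of FibreToTorus (free and periodic weak-coupling states provably differ on local
observables) kills the free-boundary presentation; pivot to the closed flat fibre ∂[0,M]³
(polyhedral sphere, no free faces). UniformLatticeGap proved by ANY route moots cruxes 2–4
(WeakCouplingContinuumLeg remains shared work); a proof of LatticeMassGapAllCouplings likewise.

NOT DECOMPOSED YET. The UV/femto half of FibreContinuity (M ≤ εξ(β), where Bałaban-type control with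
free faces should give m ≥ c/M) versus its crossover half is deliberately NOT split at open: the
split is the Two-layer plan and is earned when FibreAnchor closes. No definition item is filed for
the free tube: the vocabulary is inlined (sites, links, indicator-weighted plaquette sum, product
Haar, ratio-of-integrals expectations, time shift, time-slab locality), exactly as route
SmallCircleAnchor inlines its deformed torus; a named `freeTubeMeasure` in Literature/QuantumLattice
is a later convenience. Constants (β₀(M), m₀(M) vs the Gaussian value 2·arccosh(1+λ₁/2), L_min ≍
m/σ_eff) are not pinned. Non-triviality/OS/continuum and the weak-coupling side condition β_k → ∞
(`sch.HasWeakCouplingLimit`, re-type 2026-08-16) are entirely inside the shared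
WeakCouplingContinuumLeg and not re-decomposed here; the superseded leg ContinuumLegGivenGap
(stmt-QuantumFields-8782, one conjunct weaker, implied by it: theorem `continuumLegGivenGap_of_weak`
in Sketch.lean) was dropped from this route at the repair.

CHEAPEST FALSIFIER. (1) Gaussian level (run, by lookup): the 2001 theorem says ℤ²×F clusters iff
H¹(F;ℝ) = 0 — the free square has H¹ = 0 (contractible), rate 2−2cos(π/(M+1)) > 0: passes; a
periodic fibre (torus, H¹ ≠ 0) would FAIL already here (torons), which is why the fibre must be
contractible. (2) U(1) calibration (lookup): on free slabs U(1) has NO width-uniform gap (free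
photon; 2001 free-slab notes, Guth doi:10.1103/PhysRevD.21.2291) — consistent, since U(1) is
excluded by IsCompactSimpleLieGroup, and it pins where non-abelian input must enter. (3) The real
cheap test, for a refuter with kit access: SU(2) Monte Carlo on L²×M² tubes with open fibre
boundary, β = 2.3–2.6, M = 2…12: the effective time-correlation mass of the plaquette and of
fibre-smeared operators versus M must decrease from ≈ 2·KK to the bulk 0⁺⁺ mass MONOTONICALLY
without a dip below the bulk value (a dip = wall states = FibreContinuity in danger). Not run here
(no kit in this seat's mode); no such open-fibre spectroscopy was found in the literature searched
(Lüscher–Schaefer arXiv:1105.4749 use open b.c. in TIME only and report a boundary zone of width ≈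
1/m_0++ with no light wall modes — weak support).

NUMBERS. KK scale of the free square fibre: smallest non-zero Neumann eigenvalue of the path graph
P_(M+1) is 2−2cos(π/(M+1)) ≈ π²/(M+1)²; Gaussian clustering rate of gauge-invariant two-point
functions arccosh(1+λ₁/2) (2001 sphere-compactification, upheld). 2-d string tension of the width-M
tube at tree level σ₂ ≈ C₂(r)/(2β(M+1)²·dim r) (lattice units), so the torelon floor is L_min ≍
m₀·β(M+1)²; flavour-'t Hooft coupling of the quiver g₂²N_f ≈ 2/β (M-independent). Crossover width M
≍ ξ(β) ≍ exp(3π²β/11)·β^(−51/121) for SU(2) fundamental (two-loop). SU(3) reference ratio m_0++/T_c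
≈ 1.7 GeV/0.27 GeV ≈ 6.3 bounds the β-uniform cost of thin periodic directions in the symmetric
presentation.

DEFINITION REQUESTS. None at open (vocabulary inlined). Later convenience:
`Literature/MathematicalPhysics/QuantumLattice/FreeTube.lean` — Wilson measure on (ℤ/L)²×Fin(M+1)²
with free fibre boundary and its identification at M+1 = L, all plaquettes on, with `wilsonMeasure
(d := 4)`; cite fact wanted: the 2001 Gaussian slab theorem (clustering iff H¹(F)=0) as a Literature
named fact once re-proved (stockroom has no Lean for that route: 0 files).

Novelty: Searches (2026-08-16): `lit search --hybrid "lattice gauge theory slab two compact directions free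
boundary dimensional reduction two-dimensional Yang-Mills mass gap"` (12 book hits, none on ℤ²×F
slabs: Creutz, Montvay–Münster, Rivasseau, Meyer-Ortmanns–Reisz ch. on dimensional reduction at
finite T, Greensite); `lit vsearch` ×2 (compactification on S²/disc; deconstruction quiver) — no
relevant hit; `lit galaxy search --star all` "Yang-Mills theory on R^2 x S^2", "gauge theory on a
slab" (0/0/0), `--star pdf --mode bm25` (12 hits: van Baal femto-universe NPB PS 63,
Kovács–Tomboulis vortices, femtouniverse on a quantum computer arXiv:2211.10870 — none on
contractible-fibre tubes); `lit search --source arxiv` (0), OpenAlex/S2 rate-limited (429) today;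
`lit read arxiv:2406.19321 --grep slab` → p. 50 read; `lit frontier QuantumFields --since 2022` (30;
nearest arXiv:2601.06010 slow mixing / one-form symmetries in 3-d Z₂ gauge theory); grep of all 21
Theses and 77 Ideas of this sub for sphere / simply connected / 2-d YM / Kaluza / slab (only
SmallCircleAnchor's KK-mode integration and the closed twisted-tube card, a PERIODIC flux-threaded
fibre closed duplicate-of adiabatic-continuity-semiclassical-anchor).
Nearest prior art found: arXiv:2406.19321 §10 p. 50 (Cao–Sheffield: Gaussian-forms heuristics — slab
ℤ²×[−M,M]^(n−2) "behaves like 2D", area law and mass gap expected at FIXED M); the 2001 programme's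
sphere-compactification (archive summits/ym/routes/sphere-compactification, u  [refs: 2211.10870, 2406.19321, 2601.06010, arxiv:2406.19321]

Barriers (technique_class: contractible-fibre, dim-reduction-2d, quiver): - technique_class: contractible-fibre, dim-reduction-2d, quiver
- Literature.Barriers.QuantumFields.FiniteTemperatureDeconfinement: met head-on in the TYPING — a
thin PERIODIC direction deconfines (Borgs–Seiler), so the two long directions are a SYMMETRIC torus
L×L with clustering asked only for 2n < L and a volume floor L ≥ L_min(β,M,w); the compact
directions are FREE (no Polyakov loop exists around them), so the barrier's order parameter is
absent in the fibre by construction.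
- Literature.Barriers.QuantumFields.AbelianDeconfinementD4: it does not evade it by technique —
FibreContinuity is FALSE for U(1) (free-photon KK tower on free slabs); the bet is that the
non-abelian input enters visibly as 2-d confinement of the adjoint-CHARGED KK quiver fields (neutral
for U(1)), i.e. any proof is group-sensitive exactly at crux 2; FibreAnchor and FibreToTorus are
group-blind and claimed for U(1) too.
- Literature.Barriers.QuantumFields.EguchiKawaiBreakdown: evaded — no reduction to a small PERIODIC
volume is used; the fibre is free (no centre symmetry acting on fibre holonomies, there are none)
and the long torus is symmetric with n < L/2.
- Literature.Barriers.QuantumFields.PerturbativeInvisibility: respected — only the fixed-width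
anchor rate (a KK threshold) is perturbatively visible; the M-uniform rate m(β) of crux 2 is not
claimed from any expansion in g and is expected ≍ a(β)Λ.
- Literature.Barriers.QuantumFields.ElitzurTheorem: respected — observables are bounded gauge-inva

History (route lifecycle, newest last):
- 2026-08-16T17:43:31Z · rev 3: restated Assembly (stmt-QuantumFields-16246) — route-repair step 2/3: Assembly restated over WeakCouplingContinuumLeg (stmt-QuantumFields-15828) so the assembly item matches the re-elaborated `closes`; the o (planner-rrepair-QuantumFields-ContractibleFibr-3e6781d3-0)
- 2026-08-16T17:44:56Z · rev 4: dropped ContinuumLegGivenGap — route-repair step 3/3: drop the superseded existence leg ContinuumLegGivenGap (stmt-QuantumFields-8782) from this route — after the 2026-08-16 re-type of `YangM (planner-rrepair-QuantumFields-ContractibleFibr-3e6781d3-0)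
- 2026-08-26T06:29:12Z · DORMANT — reconciler: no traction for 8.4 d (last activity item-evidence-added at 2026-08-17T20:01:21Z); parked, not closed — `ledger route dormant route-QuantumFields-Co (operator:999:4173905)
- 2026-08-28T21:13:20Z · REACTIVATED — reconciler: reactivated — activity statement-closed at 2026-08-28T18:36:51Z after parking at 2026-08-26T06:29:12Z (operator:999:2122064)
- 2026-09-05T00:13:45Z · DORMANT — reconciler: no traction for 5 d (last activity statement-checked at 2026-08-30T23:36:16Z); parked, not closed — `ledger route dormant route-QuantumFields-Contra (operator:999:510091)

sub-problem: YangMills · status: dormant · opened planner-plan-lens-QuantumFields-resurrect2001-v2-g2-0 2026-08-16T16:29:12Z · rev 4 · ledger route-QuantumFields-ContractibleFibre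
GENERATED by the gate from the ledger (D-0016/17). Provers cite these decls: `theorem foo : Summit.QuantumFields.YangMills.Theses.ContractibleFibre.<Decl> := …` in Summits/QuantumFields/YangMills/Theorems/<Name>.lean.
-/

namespace Summit.QuantumFields.YangMills.Theses.ContractibleFibre

open scoped BigOperators Topology Manifold Classical MeasureTheory ProbabilityTheory Matrix InnerProductSpace ComplexConjugate ContinuousMap
open Filter Set Function TopologicalSpace MeasureTheory

attribute [summit_statement] _root_.YangMills

/-- item stmt-QuantumFields-8778 · target · rank 0 · open · by planner
why it might fail: It is the weak-coupling lattice mass gap (Chatterjee Problem 5.1 first half): nothing is proved for non-abelian G in d = 4 beyond strong coupling; a massless phase at some large β (as for U(1)) refutes it.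
sources: arXiv:1803.01950, JaffeWitten2000, OsterwalderSeiler1978, Literature.MathematicalPhysics.QuantumFieldTheory.LatticeMassGapAllCouplings
[target] for every compact simple Lie group G and faithful unitary lattice representation r there is
β₀ with: for all β ≥ β₀ there are m > 0 and S₁ such that for all gauge-invariant local observables
A, B there is C with |⟨A·τ_n B⟩ − ⟨A⟩⟨B⟩| ≤ C e^{−m n} on every torus (2S+1)⁴, S ≥ S₁, n ≤ S, under
Wilson's measure at coupling β (volume-uniform weak-coupling lattice mass gap; the
`latticeConnectedCorr` shape of `HasLatticeMassGap` at fixed β). -/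
@[route_item "route-QuantumFields-ContractibleFibre"]
def UniformLatticeGap : Prop :=
  ∀ (G : Type) [Group G] [TopologicalSpace G] [IsTopologicalGroup G] [CompactSpace G] [MeasurableSpace G] [BorelSpace G], Literature.MathematicalPhysics.QuantumFieldTheory.IsCompactSimpleLieGroup G → ∀ r : Literature.MathematicalPhysics.QuantumFieldTheory.LatticeRep G, ∃ β₀ : ℝ, ∀ β : ℝ, β₀ ≤ β → ∃ m : ℝ, 0 < m ∧ ∃ S₁ : ℕ, ∀ A B : Literature.MathematicalPhysics.QuantumFieldTheory.YMSpecies G, ∃ C : ℝ, ∀ S n : ℕ, S₁ ≤ S → n ≤ S → |Literature.MathematicalPhysics.QuantumFieldTheory.latticeConnectedCorr r.ρ β (2 * S + 1) A.F B.F n| ≤ C * Real.exp (-(m * n))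

/-- item stmt-QuantumFields-16242 · crux · rank 2 · open · by planner
why it might fail: At M ≍ ξ(β) the quiver is strongly coupled (g₂²N/m_KK² = O(1)) and no expansion is known; the statement is FALSE for U(1) (free photon KK tower, gap ≍ π/M → 0), so a proof must consume asymptotic freedom; free 3-d faces might carry wall states below the bulk gap.
sources: arXiv:2406.19321, hep-th/0310285, BorgsSeiler1983, arXiv:1105.4749, arXiv:1803.01950, doi:10.1103/PhysRevD.21.2291
[crux] (THE CRUX — continuity in the fibre width; 2001 sphere-compactification Path 4 "inf_R m(R) >
0", never attacked there) for every compact simple G and faithful unitary r: IF the fixed-width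
anchor holds (verbatim FibreAnchor's conclusion: for every M there are β₀(M), m₀(M) > 0 such that
for β ≥ β₀(M) the free tube (ℤ/L)²×{0..M}² clusters in time at rate m₀(M), constants C(M,β,w),
volume floor L_min), THEN there is β₁ such that for every β ≥ β₁ ONE rate m(β) > 0 and, for each
slab width w, ONE constant C (uniform in the fibre width M) give |E[F₁·F₂∘σ_n] − E[F₁]E[F₂∘σ_n]| ≤ C
e^(−m n), 2n < L, for all bounded measurable time-slab observables, on the free tubes of EVERY width
M ≥ 0 and all L ≥ L_min(β,M,w). Free tube: sites (ℤ/L)×(ℤ/L)×Fin(M+1)×Fin(M+1), links (site,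
direction ∈ Fin 4), weight exp(β Σ_x Σ_(μ<κ) 1[plaquette inside the tube]·Re tr r.ρ(U_P)) w.r.t.
product Haar (fibre plaquettes that would wrap Fin(M+1) get weight 0 = free boundary; the dangling
top-layer fibre links are decoupled Haar variables), σ_n = time shift, observables depending on
links based at times in [c, c+w]. In the quiver dictionary: the 2-d adjoint-quiver gauge theory at
flavour-'t Hooft coupling 2/ -/
@[route_item "route-QuantumFields-ContractibleFibre"]
def FibreContinuity : Prop :=
  ∀ (G : Type) [Group G] [TopologicalSpace G] [IsTopologicalGroup G] [CompactSpace G], Literature.MathematicalPhysics.QuantumFieldTheory.IsCompactSimpleLieGroup G → letI : MeasurableSpace G := borel G; haveI : BorelSpace G := ⟨rfl⟩; ∀ r : Literature.MathematicalPhysics.QuantumFieldTheory.LatticeRep G, let Tube := fun (M : ℕ) (β m C : ℝ) (w Lmin : ℕ) => ∀ (L : ℕ) [NeZero L], Lmin ≤ L → let St := ZMod L × ZMod L × Fin (M + 1) × Fin (M + 1); let Cfg := St × Fin 4 → G; let ν : MeasureTheory.Measure Cfg := MeasureTheory.Measure.pi fun _ => Literature.MathematicalPhysics.QuantumFieldTheory.haarProbability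 G; let sh : St → Fin 4 → St := fun x μ => ![(x.1 + 1, x.2.1, x.2.2.1, x.2.2.2), (x.1, x.2.1 + 1, x.2.2.1, x.2.2.2), (x.1, x.2.1, x.2.2.1 + 1, x.2.2.2), (x.1, x.2.1, x.2.2.1, x.2.2.2 + 1)] μ; let ins : St → Fin 4 → Fin 4 → ℝ := fun x μ κ => if ((μ = 2 ∨ κ = 2) → (x.2.2.1 : ℕ) < M) ∧ ((μ = 3 ∨ κ = 3) → (x.2.2.2 : ℕ) < M) then 1 else 0; let pl : Cfg → St → Fin 4 → Fin 4 → G := fun U x μ κ => U (x, μ) * U (sh x μ, κ) * (U (sh x κ, μ))⁻¹ * (U (x, κ))⁻¹; let act : Cfg → ℝ := fun U => β * ∑ x : St, ∑ q : {q : Fin 4 × Fin 4 // q.1 < q.2}, ins x q.1.1 q.1.2 * (r.ρ (pl U x q.1.1 q.1.2)).trace.re; let wgt : Cfg → ℝ := fun U => Real.exp (act U); let Ex : (Cfg → ℝ) → ℝ := fun F => (∫ U, F U * wgt U ∂ν) / (∫ U, wgt U ∂ν); let σ : ℕ → Cfg → Cfg := fun n U p => U ((p.1.1 + n, p.1.2),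 p.2); ∀ c : ZMod L, let Loc := fun F : Cfg → ℝ => Measurable F ∧ (∀ U, |F U| ≤ 1) ∧ ∀ U U', (∀ p : St × Fin 4, (p.1.1 - c).val ≤ w → U p = U' p) → F U = F U'; ∀ F₁ F₂ : Cfg → ℝ, Loc F₁ → Loc F₂ → ∀ n : ℕ, 2 * n < L → |Ex (fun U => F₁ U * F₂ (σ n U)) - Ex F₁ * Ex (fun U => F₂ (σ n U))| ≤ C * Real.exp (-(m * n)); (∀ M : ℕ, ∃ β₀ m₀ : ℝ, 0 < m₀ ∧ ∀ β : ℝ, β₀ ≤ β → ∀ w : ℕ, ∃ C : ℝ, ∃ Lmin : ℕ, Tube M β m₀ C w Lmin) → ∃ β₁ : ℝ, ∀ β : ℝ, β₁ ≤ β → ∃ m : ℝ, 0 < m ∧ ∀ w : ℕ, ∃ C : ℝ, ∀ M : ℕ, ∃ Lmin : ℕ, Tube M β m C w Lmin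

/-- item stmt-QuantumFields-16243 · crux · rank 3 · open · by planner
why it might fail: β-uniformity of the rate at fixed M may be spoiled by the 2-d string tension σ₂ → 0 (dense KK-pair bound states at threshold) or by metastable centre-element links for SU(N≥5)/large r (the Pirogov–Sinai 'unstable phases' the 2001 route met three times).
sources: arXiv:2406.19321, KoteckyPreiss1986, doi:10.1103/PhysRevD.21.446, doi:10.1007/BF01218586, arXiv:0804.2230, OsterwalderSeiler1978
[crux] (THE ANCHOR — the 2001 sphere-compactification target theorem in free-square form; its
Gaussian shadow is the upheld 2001 theorem, rate arccosh(1+λ₁/2), λ₁ = 2−2cos(π/(M+1)) here) for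
every compact simple G, faithful unitary r and EVERY fibre width M there are β₀(M) and a β-UNIFORM
rate m₀(M) > 0 such that for all β ≥ β₀(M) and every slab width w there are C and a volume floor
L_min with: on every free tube (ℤ/L)²×{0..M}² with L ≥ L_min, every pair of bounded measurable
time-slab observables clusters in time, |E[F₁·F₂∘σ_n] − E[F₁]E[F₂∘σ_n]| ≤ C e^(−m₀ n) for 2n < L
(same inline vocabulary as FibreContinuity). Intended proof: axial/tree gauge in the fibre ⇒ 2-d
G-gauge field + (M+1)²−1 G-valued adjoint scalars with KK mass terms from the mixed plaquettes; at
large β a small-field Gaussian (fibre Hodge spectrum, H¹ = 0) plus a 2-d polymer expansion in the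
long directions around the product-Haar plaquette measure (large fields by a Peierls/contour bound
with phases = irreps, as in the 2001 "2-d Yang–Mills perturbed by a positive hard-core polymer
gas"); the volume floor L_min(β,M) ≍ m₀/σ₂(β,M) pushes the spatial torelons (mass σ₂·L, σ₂ ≍
C₂/(2β(M+1)²)) above m₀. [difficulty: XL -/
@[route_item "route-QuantumFields-ContractibleFibre"]
def FibreAnchor : Prop :=
  ∀ (G : Type) [Group G] [TopologicalSpace G] [IsTopologicalGroup G] [CompactSpace G], Literature.MathematicalPhysics.QuantumFieldTheory.IsCompactSimpleLieGroup G → letI : MeasurableSpace G := borel G; haveI : BorelSpace G := ⟨rfl⟩; ∀ r : Literature.MathematicalPhysics.QuantumFieldTheory.LatticeRep G, let Tube := fun (M : ℕ) (β m C : ℝ) (w Lmin : ℕ) => ∀ (L : ℕ) [NeZero L], Lmin ≤ L → let St := ZMod L × ZMod L × Fin (M + 1) × Fin (M + 1); let Cfg := St × Fin 4 → G; let ν : MeasureTheory.Measure Cfg := MeasureTheory.Measure.pi fun _ => Literature.MathematicalPhysics.QuantumFieldTheory.haarProbability G; let sh : St → Fin 4 → St := fun x μ => ![(x.1 + 1,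 x.2.1, x.2.2.1, x.2.2.2), (x.1, x.2.1 + 1, x.2.2.1, x.2.2.2), (x.1, x.2.1, x.2.2.1 + 1, x.2.2.2), (x.1, x.2.1, x.2.2.1, x.2.2.2 + 1)] μ; let ins : St → Fin 4 → Fin 4 → ℝ := fun x μ κ => if ((μ = 2 ∨ κ = 2) → (x.2.2.1 : ℕ) < M) ∧ ((μ = 3 ∨ κ = 3) → (x.2.2.2 : ℕ) < M) then 1 else 0; let pl : Cfg → St → Fin 4 → Fin 4 → G := fun U x μ κ => U (x, μ) * U (sh x μ, κ) * (U (sh x κ, μ))⁻¹ * (U (x, κ))⁻¹; let act : Cfg → ℝ := fun U => β * ∑ x : St, ∑ q : {q : Fin 4 × Fin 4 // q.1 < q.2}, ins x q.1.1 q.1.2 * (r.ρ (pl U x q.1.1 q.1.2)).trace.re; let wgt : Cfg → ℝ := fun U => Real.exp (act U); let Ex : (Cfg → ℝ) → ℝ := fun F => (∫ U, F U * wgt U ∂ν) / (∫ U, wgt U ∂ν); let σ : ℕ → Cfg → Cfg := fun n U p => U ((p.1.1 + n, p.1.2), p.2); ∀ c : ZMod L, let Loc := fun F : Cfg → ℝ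 => Measurable F ∧ (∀ U, |F U| ≤ 1) ∧ ∀ U U', (∀ p : St × Fin 4, (p.1.1 - c).val ≤ w → U p = U' p) → F U = F U'; ∀ F₁ F₂ : Cfg → ℝ, Loc F₁ → Loc F₂ → ∀ n : ℕ, 2 * n < L → |Ex (fun U => F₁ U * F₂ (σ n U)) - Ex F₁ * Ex (fun U => F₂ (σ n U))| ≤ C * Real.exp (-(m * n)); ∀ M : ℕ, ∃ β₀ m₀ : ℝ, 0 < m₀ ∧ ∀ β : ℝ, β₀ ≤ β → ∀ w : ℕ, ∃ C : ℝ, ∃ Lmin : ℕ, Tube M β m₀ C w Lmin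

/-- item stmt-QuantumFields-16244 · crux · rank 4 · open · by planner
why it might fail: Free-tube limit states and symmetric-torus states may differ at weak coupling (ℤ⁴ Gibbs uniqueness at large β is open; 2001 found free ≠ wired states on hyperbolic lattices); S-uniform constants on the torus need vacuum dominance (Casimir-energy decay), not just a gap.
sources: arXiv:1105.4749, OsterwalderSeiler1978, arXiv:2006.16229, Seiler1982, arXiv:1803.01950
[crux] (FREE TUBES ⇒ SYMMETRIC TORUS) for every compact simple G and faithful unitary r: IF there is
β₁ such that for every β ≥ β₁ one rate m(β) > 0 and M-uniform constants cluster the free tubes of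
every width (verbatim the conclusion of FibreContinuity), THEN the UniformLatticeGap body holds for
r: β₀, and for β ≥ β₀ a rate m > 0 and S₁ with |latticeConnectedCorr r.ρ β (2S+1) A.F B.F n| ≤
C(A,B) e^(−m n) for all YMSpecies A, B, all S ≥ S₁, n ≤ S. Intended proof: M, L → ∞ along the floors
gives free-tube thermodynamic-limit states on ℤ⁴ that are reflection positive in time and cluster at
rate m(β) with the M-uniform constants; identify them with the periodic-torus states on
gauge-invariant local observables (b.c.-insensitivity at distance ≫ 1/m from the free faces,
Lüscher–Schaefer open-boundary zone), then transfer time-clustering to latticeConnectedCorr on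
(2S+1)⁴ with S-uniform constants (vacuum dominance for n ≤ S, the 2001 ym-w-pingap / ym-w-vdom
passage rows). [deps: FibreContinuity] [difficulty: L] -/
@[route_item "route-QuantumFields-ContractibleFibre"]
def FibreToTorus : Prop :=
  ∀ (G : Type) [Group G] [TopologicalSpace G] [IsTopologicalGroup G] [CompactSpace G], Literature.MathematicalPhysics.QuantumFieldTheory.IsCompactSimpleLieGroup G → letI : MeasurableSpace G := borel G; haveI : BorelSpace G := ⟨rfl⟩; ∀ r : Literature.MathematicalPhysics.QuantumFieldTheory.LatticeRep G, let Tube := fun (M : ℕ) (β m C : ℝ) (w Lmin : ℕ) => ∀ (L : ℕ) [NeZero L], Lmin ≤ L → let St := ZMod L × ZMod L × Fin (M + 1) × Fin (M + 1); let Cfg := St × Fin 4 → G; let ν : MeasureTheory.Measure Cfg := MeasureTheory.Measure.pi fun _ => Literature.MathematicalPhysics.QuantumFieldTheory.haarProbability G; let sh : St → Fin 4 → St := fun x μ => ![(x.1 + 1, x.2.1, x.2.2.1, x.2.2.2), (x.1, x.2.1 + 1, x.2.2.1, x.2.2.2), (x.1, x.2.1, x.2.2.1 + 1, x.2.2.2),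 (x.1, x.2.1, x.2.2.1, x.2.2.2 + 1)] μ; let ins : St → Fin 4 → Fin 4 → ℝ := fun x μ κ => if ((μ = 2 ∨ κ = 2) → (x.2.2.1 : ℕ) < M) ∧ ((μ = 3 ∨ κ = 3) → (x.2.2.2 : ℕ) < M) then 1 else 0; let pl : Cfg → St → Fin 4 → Fin 4 → G := fun U x μ κ => U (x, μ) * U (sh x μ, κ) * (U (sh x κ, μ))⁻¹ * (U (x, κ))⁻¹; let act : Cfg → ℝ := fun U => β * ∑ x : St, ∑ q : {q : Fin 4 × Fin 4 // q.1 < q.2}, ins x q.1.1 q.1.2 * (r.ρ (pl U x q.1.1 q.1.2)).trace.re; let wgt : Cfg → ℝ := fun U => Real.exp (act U); let Ex : (Cfg → ℝ) → ℝ := fun F => (∫ U, F U * wgt U ∂ν) / (∫ U, wgt U ∂ν); let σ : ℕ → Cfg → Cfg := fun n U p => U ((p.1.1 + n, p.1.2), p.2); ∀ c : ZMod L, let Loc := fun F : Cfg → ℝ => Measurable F ∧ (∀ U, |F U| ≤ 1) ∧ ∀ U U', (∀ p : St × Fin 4, (p.1.1 - c).val ≤ w → U p = U' p) → F U = F U';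 ∀ F₁ F₂ : Cfg → ℝ, Loc F₁ → Loc F₂ → ∀ n : ℕ, 2 * n < L → |Ex (fun U => F₁ U * F₂ (σ n U)) - Ex F₁ * Ex (fun U => F₂ (σ n U))| ≤ C * Real.exp (-(m * n)); (∃ β₁ : ℝ, ∀ β : ℝ, β₁ ≤ β → ∃ m : ℝ, 0 < m ∧ ∀ w : ℕ, ∃ C : ℝ, ∀ M : ℕ, ∃ Lmin : ℕ, Tube M β m C w Lmin) → ∃ β₀ : ℝ, ∀ β : ℝ, β₀ ≤ β → ∃ m : ℝ, 0 < m ∧ ∃ S₁ : ℕ, ∀ A B : Literature.MathematicalPhysics.QuantumFieldTheory.YMSpecies G, ∃ C : ℝ, ∀ S n : ℕ, S₁ ≤ S → n ≤ S → |Literature.MathematicalPhysics.QuantumFieldTheory.latticeConnectedCorr r.ρ β (2 * S + 1) A.F B.F n| ≤ C * Real.exp (-(m * n))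

/-- item stmt-QuantumFields-15828 · crux · rank 5 · open · by operator
why it might fail: Joint O(4)-invariant continuum limit of all gauge-invariant fields and non-Gaussianity of tr F² are open; β_k → ∞ with a_k → 0 at a fixed physical gap needs ξ(β) → ∞ as β → ∞ (unproved for non-abelian G, d = 4) and k-uniform gap prefactors.
sources: JaffeWitten2000, Balaban1989LargeFieldII, arXiv:1803.01950, OsterwalderSeiler1978, arXiv:2401.10507, Creutz2022
[crux] (existence leg, RE-TYPED for the 2026-08-16 Statement) for every compact simple Lie group G:
IF for every faithful unitary r the volume-uniform weak-coupling lattice gap holds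
(UniformLatticeGap body for G, Borel σ-algebra), THEN there are r, a sequential scheme sch WITH β_k
→ ∞ (`sch.HasWeakCouplingLimit`) and OS data T with IsYangMillsFor r sch T, T non-trivial and
non-Gaussian in tr F², and Δ > 0 with T.HasMassGap Δ ∧ HasLatticeMassGap r sch Δ. Intended use: a_k
∝ m(β_k) with β_k → ∞ (ξ(β) → ∞ is 2001-refereed and hub-filed: DirichletWindow /
XiCompleteMonotonicity), joint continuum limit with E0–E4 at that scale (Bałaban UV control, E1 by
any of the hub's rotation routes), non-triviality from the curvature three/four-point function.
[deps: UniformLatticeGap] [difficulty: open-problem] -/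
@[route_item "route-QuantumFields-ContractibleFibre"]
def WeakCouplingContinuumLeg : Prop :=
  ∀ (G : Type) [Group G] [TopologicalSpace G] [IsTopologicalGroup G] [CompactSpace G], Literature.MathematicalPhysics.QuantumFieldTheory.IsCompactSimpleLieGroup G → letI : MeasurableSpace G := borel G; haveI : BorelSpace G := ⟨rfl⟩; (∀ r : Literature.MathematicalPhysics.QuantumFieldTheory.LatticeRep G, ∃ β₀ : ℝ, ∀ β : ℝ, β₀ ≤ β → ∃ m : ℝ, 0 < m ∧ ∃ S₁ : ℕ, ∀ A B : Literature.MathematicalPhysics.QuantumFieldTheory.YMSpecies G, ∃ C : ℝ, ∀ S n : ℕ, S₁ ≤ S → n ≤ S → |Literature.MathematicalPhysics.QuantumFieldTheory.latticeConnectedCorr r.ρ β (2 * S + 1) A.F B.F n| ≤ C * Real.exp (-(m * n))) → ∃ (r : Literature.MathematicalPhysics.QuantumFieldTheory.LatticeRep G) (sch : Literature.MathematicalPhysics.QuantumFieldTheory.SpeciesScheme (Literature.MathematicalPhysics.QuantumFieldTheory.YMSpecies G)) (T : Literature.MathematicalPhysics.QuantumFieldTheory.OSData (Literature.MathematicalPhysics.QuantumFieldTheory.YMSpecies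 G) 4), sch.HasWeakCouplingLimit ∧ Literature.MathematicalPhysics.QuantumFieldTheory.IsYangMillsFor r sch T ∧ T.IsNontrivial r.curvature ∧ T.IsNonGaussian r.curvature ∧ ∃ Δ > 0, T.HasMassGap Δ ∧ Literature.MathematicalPhysics.QuantumFieldTheory.HasLatticeMassGap r sch Δ

/-- item stmt-QuantumFields-16245 · support · rank 9 · closed · proved by Summit.QuantumFields.YangMills.Theorems.planarAnchor_proof @ dc9067feea5e (prover) · by planner
sources: doi:10.1103/PhysRevD.21.446, doi:10.1007/BF01218586, arXiv:0804.2230, OsterwalderSeiler1978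
[support] (SPECIAL CASE M = 0 of FibreAnchor — the planar member, implied by instantiation, theorem
`planar_of_anchor` in Sketch.lean) with a one-point fibre the free tube is two-dimensional lattice
Yang–Mills in the representation r on the torus (ℤ/L)² (plus decoupled dangling links): exactly
solvable by the character expansion; time-slab observables cluster at a β-uniform rate m₀ once L ≥
L_min(β) ≍ m₀·2β/C₂(r) (the only slow modes are the spatial Polyakov loop / torelon sectors, mass
σ₂(β)·L with σ₂ ≍ C₂/(2β·dim)). The calibration of the inline vocabulary and the first milestone
(2-d transfer matrix on class functions of one holonomy × independent plaquette variables).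
[difficulty: M] -/
@[route_item "route-QuantumFields-ContractibleFibre"]
def PlanarAnchor : Prop :=
  ∀ (G : Type) [Group G] [TopologicalSpace G] [IsTopologicalGroup G] [CompactSpace G], Literature.MathematicalPhysics.QuantumFieldTheory.IsCompactSimpleLieGroup G → letI : MeasurableSpace G := borel G; haveI : BorelSpace G := ⟨rfl⟩; ∀ r : Literature.MathematicalPhysics.QuantumFieldTheory.LatticeRep G, let Tube := fun (M : ℕ) (β m C : ℝ) (w Lmin : ℕ) => ∀ (L : ℕ) [NeZero L], Lmin ≤ L → let St := ZMod L × ZMod L × Fin (M + 1) × Fin (M + 1); let Cfg := St × Fin 4 → G; let ν : MeasureTheory.Measure Cfg := MeasureTheory.Measure.pi fun _ => Literature.MathematicalPhysics.QuantumFieldTheory.haarProbability G; let sh : St → Fin 4 → St := fun x μ => ![(x.1 + 1, x.2.1, x.2.2.1, x.2.2.2), (x.1, x.2.1 + 1, x.2.2.1, x.2.2.2), (x.1, x.2.1, x.2.2.1 + 1, x.2.2.2), (x.1, x.2.1, x.2.2.1, x.2.2.2 + 1)] μ; let ins : St → Fin 4 → Fin 4 → ℝ := fun x μ κ => if ((μ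 = 2 ∨ κ = 2) → (x.2.2.1 : ℕ) < M) ∧ ((μ = 3 ∨ κ = 3) → (x.2.2.2 : ℕ) < M) then 1 else 0; let pl : Cfg → St → Fin 4 → Fin 4 → G := fun U x μ κ => U (x, μ) * U (sh x μ, κ) * (U (sh x κ, μ))⁻¹ * (U (x, κ))⁻¹; let act : Cfg → ℝ := fun U => β * ∑ x : St, ∑ q : {q : Fin 4 × Fin 4 // q.1 < q.2}, ins x q.1.1 q.1.2 * (r.ρ (pl U x q.1.1 q.1.2)).trace.re; let wgt : Cfg → ℝ := fun U => Real.exp (act U); let Ex : (Cfg → ℝ) → ℝ := fun F => (∫ U, F U * wgt U ∂ν) / (∫ U, wgt U ∂ν); let σ : ℕ → Cfg → Cfg := fun n U p => U ((p.1.1 + n, p.1.2), p.2); ∀ c : ZMod L, let Loc := fun F : Cfg → ℝ => Measurable F ∧ (∀ U, |F U| ≤ 1) ∧ ∀ U U', (∀ p : St × Fin 4, (p.1.1 - c).val ≤ w → U p = U' p) → F U = F U'; ∀ F₁ F₂ : Cfg → ℝ, Loc F₁ → Loc F₂ → ∀ n : ℕ, 2 * n < L → |Ex (fun U => F₁ U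 * F₂ (σ n U)) - Ex F₁ * Ex (fun U => F₂ (σ n U))| ≤ C * Real.exp (-(m * n)); ∃ β₀ m₀ : ℝ, 0 < m₀ ∧ ∀ β : ℝ, β₀ ≤ β → ∀ w : ℕ, ∃ C : ℝ, ∃ Lmin : ℕ, Tube 0 β m₀ C w Lmin

-- `PlanarAnchor` holds: proved by `Summit.QuantumFields.YangMills.Theorems.planarAnchor_proof` @ dc9067feea5e (its module imports this route file, so no `_holds` link can be stated here).

-- earlier Assembly (stmt-QuantumFields-16246, replaced 2026-08-16T17:43:31Z -> stmt-QuantumFields-16149): retired by None — FibreAnchor → FibreContinuity → FibreToTorus → ContinuumLegGivenGap → YangMills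
/-- item stmt-QuantumFields-16149 · assembly · rank 1 · closed · proved by Summit.QuantumFields.YangMills.Theorems.contractibleFibre_assembly_proof (prover) · by planner
sources: JaffeWitten2000, hep-th/0310285
[assembly] FibreAnchor → FibreContinuity → FibreToTorus → WeakCouplingContinuumLeg → YangMills (pure
logic; the deciding theorem `closes` proves it — `assembly_holds` in the planner's Sketch.lean;
restated at the 2026-08-16 route-repair over the weak-coupling existence leg, item
stmt-QuantumFields-15828, replacing the superseded leg ContinuumLegGivenGap
stmt-QuantumFields-8782). -/
@[route_item "route-QuantumFields-ContractibleFibre"]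
def Assembly : Prop :=
  FibreAnchor → FibreContinuity → FibreToTorus → WeakCouplingContinuumLeg → YangMills

-- `Assembly` holds: proved by `Summit.QuantumFields.YangMills.Theorems.contractibleFibre_assembly_proof` (its module imports this route file, so no `_holds` link can be stated here).

/-! D-0027 §2.1 — DECIDING THEOREM (planner-authored via `route open/edit --closes-file`; by planner-rrepair-QuantumFields-ContractibleFibr-3e6781d3-0 2026-08-16T17:42:15Z):
its hypotheses are this route's items and its conclusion the sub-problem Statement (glue_lint), and it elaborates with this file. -/

@[closes "route-QuantumFields-ContractibleFibre"] theorem closes (h₁ : FibreAnchor) (h₂ : FibreContinuity) (h₃ : FibreToTorus)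
    (h₄ : WeakCouplingContinuumLeg) : YangMills := by
  intro G _ _ _ _ hG
  refine h₄ G hG fun r => ?_
  exact h₃ G hG r (h₂ G hG r (h₁ G hG r))

end Summit.QuantumFields.YangMills.Theses.ContractibleFibre
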